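import Summits.ValiantsHypothesis.ValiantsHypothesis.Theorems.KPlusLogSqLawTropicalBTopHeavyCoreCensus
import Summits.ValiantsHypothesis.ValiantsHypothesis.Theorems.KPlusLogSqLawTropicalBTopHeavyCoreTransfer
import Summits.ValiantsHypothesis.ValiantsHypothesis.Theorems.KPlusLogSqLawTropicalBTopHeavyCoreConcave
import Summits.ValiantsHypothesis.ValiantsHypothesis.Theorems.KPlusLogSqLawTropicalBClassReversal

/-!
# Route «KPlusLogSqLaw», crux `TropicalB` (stmt-ValiantsHypothesis-19771) — THE MIRROR CELLS OF THE TOP-HEAVY LAWS: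
# one ISOLATED LIGHT class below a cluster is never counting-tight (every `m ≥ 2`), e.g. `d = (0, m, m+1, m+2, m+3)`

HONEST FRAMING.  Census corollaries (val-sym-trop-p1 g21, cell `pub-symmetroid`, 2026-08-28; `--supports stmt-ValiantsHypothesis-19771 --as helper`)
of this seat's top-heavy / parity-at-every-size / concave censuses (`designRowD_core`, `designRowD_parity_all`, `designRowD_concave_all`) transported
through the class-reversal duality of the unsigned row (`ClassReversal.designRowD_of_classRev`, val-sym-trop-p5 g12: reverse the classes, reflect the
exponents at the maximum, read the chain backwards).  Finite-format statements; nothing here bears on `TropicalB` in its window, `WeakLifting`,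
DoorA26 / DoorA34, `MatrixDescartes` (stmt-ValiantsHypothesis-18050) or VP ≠ VNP.

With `a₄` a class of MAXIMAL exponent, `d a₁ < d a₂ < d a₃ < d a₄`, and any class `a₀` (the light one):
* `designRowD_core_mirror` — `(m−1)·d a₄ + d a₀ < (m−2)·d a₃ + 2·d a₂` and `< (m−1)·d a₃ + d a₁` ⇒ unsigned row `≤ multichoose K m − 2`
  (missed: `a₃^{m−2} a₂²`, `a₃^{m−1} a₁` or `a₄^{m−1} a₀`);
* `designRowD_parity_all_mirror` — `(m−1)·d a₄ + d a₀ < m·d a₂` and `< (m−1)·d a₃ + d a₁` (missed: `a₂^m`, `a₃^{m−1} a₁` or `a₄^{m−1} a₀`);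
* `designRowD_concave_all_mirror` — budget `2·d a₂ ≤ d a₁ + d a₄`, `(m−1)·d a₄ + d a₀ < d a₃ + (m−1)·d a₁` and `< m·d a₂`;
* `designRowD_bottomLight_five`, `designRowD_bottomLight_five_example` — the `K = 5` column and the instance `d = (0, m, m+1, m+2, m+3)` at every
  `m ≥ 2`: a bottom gap of `m` below four consecutive exponents already costs a histogram (the mirror lex census …LexCensusMirror needs gaps
  decreasing FAST and `m ≥ 4`; here one gap suffices).
[this cell]
-/

set_option linter.dupNamespace false
set_option autoImplicit false

namespace Summit.ValiantsHypothesis.ValiantsHypothesis.Theorems.KPlusLogSqLaw.TopHeavyCore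

open Summit.ValiantsHypothesis.ValiantsHypothesis.Theorems.MatrixDescartes.Negative
open Finset

variable {m K : ℕ}

/-- **BOTTOM-LIGHT CENSUS (mirror of the top-heavy census).**  `m ≥ 2`; `d a₁ < d a₂ < d a₃ < d a₄` with `d a₄` maximal, and a class `a₀` with
`(m−1)·d a₄ + d a₀ < (m−2)·d a₃ + 2·d a₂` and `(m−1)·d a₄ + d a₀ < (m−1)·d a₃ + d a₁`: the unsigned row is `≤ multichoose K m − 2`. [this cell] -/
theorem designRowD_core_mirror (hm : 2 ≤ m) (d : Fin K → ℕ) (v ε : Fin m → Fin m → Fin K → ℤ) (a₀ a₁ a₂ a₃ a₄ : Fin K)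
    (h12 : d a₁ < d a₂) (h23 : d a₂ < d a₃) (h34 : d a₃ < d a₄) (hmax : ∀ l, d l ≤ d a₄)
    (hAC : (m - 1 : ℤ) * d a₄ + d a₀ < (m - 2 : ℤ) * d a₃ + 2 * d a₂) (hBC : (m - 1 : ℤ) * d a₄ + d a₀ < (m - 1 : ℤ) * d a₃ + d a₁) :
    DesignRowD d v ε (Nat.multichoose K m - 2) := by
  refine ClassReversal.designRowD_of_classRev d (d a₄) v ε hmax _ ?_
  have h0 := hmax a₀; have h1 := hmax a₁; have h2 := hmax a₂; have h3 := hmax a₃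
  refine designRowD_core hm _ _ _ (Fin.rev a₄) (Fin.rev a₃) (Fin.rev a₂) (Fin.rev a₁) (Fin.rev a₀) ?_ ?_ ?_ ?_ ?_ ?_
  · simp only [Fin.rev_rev]; omega
  · simp only [Fin.rev_rev]; omega
  · simp only [Fin.rev_rev]; omega
  · intro l; simp only [Fin.rev_rev]; omega
  · simp only [Fin.rev_rev]; push_cast [Nat.cast_sub h0, Nat.cast_sub h2, Nat.cast_sub h3, Nat.sub_self]; linarith
  · simp only [Fin.rev_rev]; push_cast [Nat.cast_sub h0, Nat.cast_sub h1, Nat.cast_sub h3, Nat.sub_self]; linarith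

/-- **MIRROR OF THE PARITY CENSUS AT EVERY SIZE.**  `m ≥ 2`; `d a₁ < d a₂ < d a₃ < d a₄` with `d a₄` maximal, and a class `a₀` with
`(m−1)·d a₄ + d a₀ < m·d a₂` and `(m−1)·d a₄ + d a₀ < (m−1)·d a₃ + d a₁`: the unsigned row is `≤ multichoose K m − 2`. [this cell] -/
theorem designRowD_parity_all_mirror (hm : 2 ≤ m) (d : Fin K → ℕ) (v ε : Fin m → Fin m → Fin K → ℤ) (a₀ a₁ a₂ a₃ a₄ : Fin K)
    (h12 : d a₁ < d a₂) (h23 : d a₂ < d a₃) (h34 : d a₃ < d a₄) (hmax : ∀ l, d l ≤ d a₄)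
    (hAC : (m - 1 : ℤ) * d a₄ + d a₀ < (m : ℤ) * d a₂) (hBC : (m - 1 : ℤ) * d a₄ + d a₀ < (m - 1 : ℤ) * d a₃ + d a₁) :
    DesignRowD d v ε (Nat.multichoose K m - 2) := by
  refine ClassReversal.designRowD_of_classRev d (d a₄) v ε hmax _ ?_
  have h0 := hmax a₀; have h1 := hmax a₁; have h2 := hmax a₂; have h3 := hmax a₃
  refine designRowD_parity_all hm _ _ _ (Fin.rev a₄) (Fin.rev a₃) (Fin.rev a₂) (Fin.rev a₁) (Fin.rev a₀) ?_ ?_ ?_ ?_ ?_ ?_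
  · simp only [Fin.rev_rev]; omega
  · simp only [Fin.rev_rev]; omega
  · simp only [Fin.rev_rev]; omega
  · intro l; simp only [Fin.rev_rev]; omega
  · simp only [Fin.rev_rev]; push_cast [Nat.cast_sub h0, Nat.cast_sub h2, Nat.sub_self]; linarith
  · simp only [Fin.rev_rev]; push_cast [Nat.cast_sub h0, Nat.cast_sub h1, Nat.cast_sub h3, Nat.sub_self]; linarith

/-- **MIRROR OF THE CONCAVE CENSUS AT EVERY SIZE.**  `m ≥ 2`; `d a₁ < d a₂ < d a₃ < d a₄` with `d a₄` maximal, budget `2·d a₂ ≤ d a₁ + d a₄`, and a class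
`a₀` with `(m−1)·d a₄ + d a₀ < d a₃ + (m−1)·d a₁` and `(m−1)·d a₄ + d a₀ < m·d a₂`: the unsigned row is `≤ multichoose K m − 2`. [this cell] -/
theorem designRowD_concave_all_mirror (hm : 2 ≤ m) (d : Fin K → ℕ) (v ε : Fin m → Fin m → Fin K → ℤ) (a₀ a₁ a₂ a₃ a₄ : Fin K)
    (h12 : d a₁ < d a₂) (h23 : d a₂ < d a₃) (h34 : d a₃ < d a₄) (hmax : ∀ l, d l ≤ d a₄) (hbudget : 2 * d a₂ ≤ d a₁ + d a₄)
    (hAC : (m - 1 : ℤ) * d a₄ + d a₀ < (d a₃ : ℤ) + (m - 1 : ℤ) * d a₁) (hBC : (m - 1 : ℤ) * d a₄ + d a₀ < (m : ℤ) * d a₂) :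
    DesignRowD d v ε (Nat.multichoose K m - 2) := by
  refine ClassReversal.designRowD_of_classRev d (d a₄) v ε hmax _ ?_
  have h0 := hmax a₀; have h1 := hmax a₁; have h2 := hmax a₂; have h3 := hmax a₃
  refine designRowD_concave_all hm _ _ _ (Fin.rev a₄) (Fin.rev a₃) (Fin.rev a₂) (Fin.rev a₁) (Fin.rev a₀) ?_ ?_ ?_ ?_ ?_ ?_
  · simp only [Fin.rev_rev]; omega
  · simp only [Fin.rev_rev]; omega
  · simp only [Fin.rev_rev]; omega
  · simp only [Fin.rev_rev]; omega
  · simp only [Fin.rev_rev]; push_cast [Nat.cast_sub h0, Nat.cast_sub h1, Nat.cast_sub h3, Nat.sub_self]; linarith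
  · simp only [Fin.rev_rev]; push_cast [Nat.cast_sub h0, Nat.cast_sub h2, Nat.sub_self]; linarith

/-- **THE `K = 5` COLUMN, BOTTOM-LIGHT (`m ≥ 2`)**: sorted `d : Fin 5 → ℕ` (`d 1 < d 2 < d 3 < d 4`, `d 0 ≤ d 4`) with `(m−1)·d 4 + d 0 < (m−2)·d 3 + 2·d 2` and
`(m−1)·d 4 + d 0 < (m−1)·d 3 + d 1` ⇒ unsigned row `≤ multichoose 5 m − 2 = C(m+4,4) − 2`. [this cell] -/
theorem designRowD_bottomLight_five (hm : 2 ≤ m) (d : Fin 5 → ℕ) (h12 : d 1 < d 2) (h23 : d 2 < d 3) (h34 : d 3 < d 4) (h04 : d 0 ≤ d 4)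
    (hAC : (m - 1 : ℤ) * d 4 + d 0 < (m - 2 : ℤ) * d 3 + 2 * d 2) (hBC : (m - 1 : ℤ) * d 4 + d 0 < (m - 1 : ℤ) * d 3 + d 1)
    (v ε : Fin m → Fin m → Fin 5 → ℤ) : DesignRowD d v ε (Nat.multichoose 5 m - 2) := by
  refine designRowD_core_mirror hm d v ε 0 1 2 3 4 h12 h23 h34 ?_ hAC hBC
  intro l
  fin_cases l
  · exact h04
  · exact (h12.trans (h23.trans h34)).le
  · exact (h23.trans h34).le
  · exact h34.le
  · exact le_rfl

/-- the bottom-light instance `d = (0, m, m+1, m+2, m+3)`, every `m ≥ 2` (at `m = 3`: `(0,3,4,5,6)`, so `T_D(3,5; (0,3,4,5,6)) ≤ 33`). [this cell] -/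
theorem designRowD_bottomLight_five_example (hm : 2 ≤ m) (v ε : Fin m → Fin m → Fin 5 → ℤ) :
    DesignRowD (![0, m, m + 1, m + 2, m + 3] : Fin 5 → ℕ) v ε (Nat.multichoose 5 m - 2) := by
  refine designRowD_bottomLight_five hm _ (by simp) (by simp) (by simp) (by simp) ?_ ?_ v ε
  · simp only [Matrix.cons_val_zero, Matrix.cons_val]
    push_cast
    have : (2 : ℤ) ≤ m := by exact_mod_cast hm
    nlinarith
  · simp only [Matrix.cons_val_zero, Matrix.cons_val_one, Matrix.cons_val]
    push_cast
    have : (2 : ℤ) ≤ m := by exact_mod_cast hm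
    nlinarith

end Summit.ValiantsHypothesis.ValiantsHypothesis.Theorems.KPlusLogSqLaw.TopHeavyCore
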